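import Mathlib
import Summits.Ventures.FusionMHD.Bench.SAlphaW25A215Panels
import Summits.Ventures.FusionMHD.Bench.SAlphaW25A258Panels
import Summits.Ventures.FusionMHD.Bench.BallooningSAlphaWitness062Band
import HarnessLib

/-!
# F3 — THE UNSTABLE BAND OF THE `s–α` MODEL AT UNIT SHEAR, CERTIFIED UP TO THE SECOND-STABILITY SIDE: `U₁ ⊇ [31/50, 129/50]` — a second
# finite-element trial function (window `[−16, 16]`, tuned at `α = 5/2`) is a witness at `α = 43/20` AND at `α = 129/50`, hence (convexity in `α`) on
# `[43/20, 129/50]`; with the `[−32, 32]` band `[31/50, 43/20]` of `BallooningSAlphaWitness062Band` every `α ∈ [0.62, 2.58]` is certified unstable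
(venture LADDER-GRIDFUSION, rung F3; cell `gridfusion`, typed by gridfusion-lit-3 (g14), 2026-08-28.  ONE composition file: 0 `def … : Prop` facts, 0 defs,
0 kit jobs, no `native_decide`, no floating point in any statement; 2 × 16 kernel panel enclosures in the panel files.)

## The statement (three columns, never merged)
CERTIFIED (kernel): for the `s–α` model EXACTLY as typed (12.97)/(12.38) at `s = 1`:
* `unstableWitness_215` / `unstableWitness_258`: the `[−16, 16]` spline `X₂ = Spline.trialX 1 1 SAlphaW25.pieces (−16)` is an `UnstableWitness` at
  `α = 43/20` (`W ≈ −0.518`) and at `α = 129/50` (`W ≈ −0.0300`); `unstableWitness_band₂`: hence at every `α ∈ [43/20, 129/50]`;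
* ★★ `unstable_band_unit_shear`: `∀ α ∈ Icc (31/50) (129/50), ∃ a b X X′, SAlpha.UnstableWitness 1 α a b X X′` — EVERY surface `(1, α)` with
  `0.62 ≤ α ≤ 2.58` is ballooning-unstable in the model's one-surface sense (two trial functions, four point certificates, convexity).
  With ★ #213′ (`StableSide 1 (29/50)`) and ★ #240: the FIRST edge of `U₁` lies in `[29/50, 31/50]` and `U₁` reaches at least `129/50`; with
  `BallooningSAlphaSmallGradient`: `[0, 1/14]` is stable.  The analytic interval `[87/100, 227/100]` of ★ #184 (model-7,
  `SAlphaQuarticBump.unstableWitness_one_of_mem`) is extended on BOTH sides (`0.62 … 2.58`).  NOTHING is certified above `129/50` (the second-stability side of the model at `s = 1`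
  is float only: `λ_min > 0` at `α = 3`; the witness `X₂` itself stops at `α ≈ 2.5997`).
VALIDATED (juxtaposed, not used): float `λ_min(α)` of the Dirichlet form on `[−16, 16]`: `−0.098 (α = 2.5)`, `+0.46 (3.0)`; Freidberg Fig. 12.5
(first and second stability regions of the `s–α` diagram).  MODELLED: the `s–α` model; representation step quoted (`BallooningSAlpha.lean`); no device.

## Sources
* J. P. Freidberg, *Ideal MHD*, CUP 2014 [Freidberg2014]: §12.3 eqs. (12.38)–(12.40), §12.6.2 eq. (12.97) and the second-stability discussion
  after (12.100) [corpus: book:freidbergnd-ideal-mhd p0532], Fig. 12.5 (via the imports).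
* A. Mahboubi, G. Melquiond, T. Sibut-Pinote, ITP 2016 [MahboubiMelquiondSibutpinote2016] §3.2–§3.3 (via the panel files).
-/

noncomputable section

open Literature.Analysis.ValidatedNumerics Literature.Analysis.ValidatedNumerics.PolyMP
open Literature.Analysis.ValidatedNumerics.NumericsMP Literature.Analysis.ValidatedNumerics.ExpPoly
open Literature.MathematicalPhysics.MHD.Ballooning Literature.MathematicalPhysics.MHD.Ballooning.SAlpha
open Literature.MathematicalPhysics.MHD.Ballooning.SAlpha.Spline
open Set

namespace Summit.Ventures.FusionMHD.Bench.SAlphaW25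

/-- THE GLUED SEGMENT at `α = 43/20` in summed form. [cite: MahboubiMelquiondSibutpinote2016, Sect. 3.3] -/
theorem c215_seg_all :
    FSegOK (splineDensity 1 (43/20) (-16) 1 1 pieces) [1] (2 ^ 60) (panelLeft 1 0) (panelLeft 1 16) (-597301697269727232) (-597301207563763712) := by
  have h := c215_seg
  norm_num at h
  exact h

/-- THE `[−16, 16]` TRIAL FUNCTION IS A WITNESS AT `(1, 43/20)`: `UnstableWitness 1 (43/20) (−16) 16 X X′`, `2⁶⁰·W ≤ -597301207563763712` (`W ≈ -0.5181`).
[cite: Freidberg2014, §12.3 eqs. (12.38)–(12.40)] -/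
theorem unstableWitness_215 :
    UnstableWitness 1 (43/20) (-16) 16 (trialX 1 1 pieces (-16)) (trialX' 1 1 pieces (-16)) := by
  have h := unstableWitness_of_spline (s := 1) (α := 43/20) (a := -16) (h := 1) (m := 1) (ps := pieces)
    one_pos one_pos pieces_ne_nil pieces_match pieces_deriv_match head_zero last_zero c215_seg_all (by decide)
  rw [pieces_length] at h
  norm_num at h
  exact h

/-- THE GLUED SEGMENT at `α = 129/50` in summed form. [cite: MahboubiMelquiondSibutpinote2016, Sect. 3.3] -/
theorem c258_seg_all :
    FSegOK (splineDensity 1 (129/50) (-16) 1 1 pieces) [1] (2 ^ 60) (panelLeft 1 0) (panelLeft 1 16) (-34581675230887936) (-34580969964961792) := by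
  have h := c258_seg
  norm_num at h
  exact h

/-- THE `[−16, 16]` TRIAL FUNCTION IS A WITNESS AT `(1, 129/50)`: `UnstableWitness 1 (129/50) (−16) 16 X X′`, `2⁶⁰·W ≤ -34580969964961792` (`W ≈ -0.0300`).
[cite: Freidberg2014, §12.3 eqs. (12.38)–(12.40)] -/
theorem unstableWitness_258 :
    UnstableWitness 1 (129/50) (-16) 16 (trialX 1 1 pieces (-16)) (trialX' 1 1 pieces (-16)) := by
  have h := unstableWitness_of_spline (s := 1) (α := 129/50) (a := -16) (h := 1) (m := 1) (ps := pieces)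
    one_pos one_pos pieces_ne_nil pieces_match pieces_deriv_match head_zero last_zero c258_seg_all (by decide)
  rw [pieces_length] at h
  norm_num at h
  exact h

/-- THE SECOND BAND: the `[−16, 16]` trial function is a witness at every `α ∈ [43/20, 129/50]` (convexity in `α`).
[cite: Freidberg2014, §12.3 eqs. (12.38)–(12.40)] -/
theorem unstableWitness_band₂ :
    ∀ α ∈ Icc (43/20 : ℝ) (129/50), UnstableWitness 1 α (-16) 16 (trialX 1 1 pieces (-16)) (trialX' 1 1 pieces (-16)) :=
  unstableWitness_of_mem_Icc unstableWitness_215 unstableWitness_258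

/-- ★★ THE UNSTABLE BAND AT UNIT SHEAR: every `s–α` model surface `(1, α)` with `31/50 ≤ α ≤ 129/50` carries an instability witness (the `[−32, 32]`
spline for `α ≤ 43/20`, the `[−16, 16]` spline for `α ≥ 43/20`): `U₁ ⊇ [31/50, 129/50]`. [cite: Freidberg2014, §12.3 eqs. (12.38)–(12.40)]
(«… The plasma is unstable», for the whole band of the MODEL) -/
theorem unstable_band_unit_shear {α : ℝ} (hα : α ∈ Icc (31/50 : ℝ) (129/50)) :
    ∃ a b : ℝ, ∃ X X' : ℝ → ℝ, UnstableWitness 1 α a b X X' := by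
  by_cases h : α ≤ 43/20
  · exact ⟨-32, 32, _, _, SAlphaW062.unstableWitness_band α ⟨hα.1, h⟩⟩
  · exact ⟨-16, 16, _, _, unstableWitness_band₂ α ⟨le_of_lt (not_le.mp h), hα.2⟩⟩

/-- … in particular no `α` of the band is on the stable side. [cite: Freidberg2014, §12.3 eq. (12.40)] -/
theorem not_stableSide_of_mem_band {α : ℝ} (hα : α ∈ Icc (31/50 : ℝ) (129/50)) : ¬ StableSide 1 α := by
  obtain ⟨a, b, X, X', hw⟩ := unstable_band_unit_shear hα
  exact fun hs => hs a b X X' hw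

end Summit.Ventures.FusionMHD.Bench.SAlphaW25

end
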